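import Summits.Ventures.Crystal3D.Theorems.StickyWulffConstantCoaxialWallLawReflectionWords
import Summits.Ventures.Crystal3D.Theorems.StickyWulffConstantGenericWallFloorCutNormals
import HarnessLib

/-!
# Reduced words in the four `{111}` reflections, II: free reduction, `Γ₀ ∩ GL₃(ℤ) = {1}`, trivial stabiliser of `D₊`
# (crux `CoaxialWallLaw`, stmt-Ventures-19481, line `WallLedgerF`; item (L1) of the module-capture plan, continued)

HONEST FRAMING. Venture `Summits/Ventures/Crystal3D` (cell `crystal3d-full`), helper `--supports` the crux `CoaxialWallLaw`
of `route-Ventures-StickyWulffConstant` (REGISTERED line `WallLedgerF`, skeleton `Certificates` v3, registered stub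
`stub_moduleCapture`).  Continues `…ReflectionWords` (the `3`-adic normal form and reduced-word injectivity).  Rung credit
only; F-C1 not moved; census-free.

* `push`, `reduce` — FREE REDUCTION to the normal form; `wordMat_reduce` (same matrix), `isChain_reduce` (reduced),
  `reduce_eq_self`, `length_reduce_le`;
* `wordMat_eq_iff_reduce_eq` — **NORMAL FORM THEOREM** (`Γ₀ ≅ (ℤ/2)^{*4}`): two words have the same matrix iff they have the
  same normal form; `wordMat_eq_one_iff`; `wordMat_reverse_eq_iff`;
* `reduce_eq_nil_of_forall_intCast` — **`Γ₀ ∩ GL₃(ℤ) = {1}`**, in particular `Γ₀ ∩ O_h = {1}` (`O_h` = signed permutations);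
* `slotQ` (the tree's `NearIdentity.slotInt` over `ℚ`), `exists_far_slot`, `exists_slot_mulVec_ne_intCast` — a non-empty
  reduced word moves a far slot of its last letter off `ℤ³`; `reduce_eq_nil_of_mapsTo_slots` — **TRIVIAL STABILISER OF `D₊`**
  (a word mapping the slot dozen into itself is trivial); `reduce_eq_of_mapsTo_slots` — **RIGIDITY**: `M_u D₊ ⊆ M_v D₊ ⇒
  reduce u = reduce v` (two reduced words with the same slot-dozen image are equal).
WHAT THIS IS NOT: not the stub, no statement about configurations; F-C1 not moved.
-/

namespace Summit.Ventures.Crystal3D.Theorems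

namespace ReflWord

open Matrix

/-! ### Free reduction (the normal form) -/

/-- A one-letter word is the letter. -/
theorem wordMat_singleton (i : Fin 4) : wordMat [i] = M i := by
  rw [wordMat_cons, wordMat_nil, mul_one]

/-- Push a letter onto a reduced word, cancelling an equal head letter (`M_a M_a = 1`). -/
def push (a : Fin 4) : List (Fin 4) → List (Fin 4)
  | [] => [a]
  | b :: t => if a = b then t else a :: b :: t

/-- FREE REDUCTION of a word to its normal form (a reduced word with the same matrix). -/
def reduce (w : List (Fin 4)) : List (Fin 4) := w.foldr push []

/-- The empty word is reduced. -/
@[simp] theorem reduce_nil : reduce [] = [] := rfl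

/-- `reduce (a :: w) = push a (reduce w)`. -/
theorem reduce_cons (a : Fin 4) (w : List (Fin 4)) : reduce (a :: w) = push a (reduce w) := rfl

/-- `push` multiplies by the letter. -/
theorem wordMat_push (a : Fin 4) (t : List (Fin 4)) : wordMat (push a t) = M a * wordMat t := by
  cases t with
  | nil => rfl
  | cons b t =>
    simp only [push]
    split_ifs with h
    · subst h; rw [wordMat_cons, ← mul_assoc, M_mul_self, one_mul]
    · rfl

/-- **Reduction preserves the matrix.** -/
theorem wordMat_reduce (w : List (Fin 4)) : wordMat (reduce w) = wordMat w := by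
  induction w with
  | nil => rfl
  | cons a w ih => rw [reduce_cons, wordMat_push, ih, wordMat_cons]

/-- `push` preserves reducedness. -/
theorem isChain_push (a : Fin 4) {t : List (Fin 4)} (ht : t.IsChain (· ≠ ·)) : (push a t).IsChain (· ≠ ·) := by
  cases t with
  | nil => exact List.isChain_singleton a
  | cons b t =>
    simp only [push]
    split_ifs with h
    · exact ht.tail
    · exact List.isChain_cons_cons.2 ⟨h, ht⟩

/-- **The normal form is reduced.** -/
theorem isChain_reduce (w : List (Fin 4)) : (reduce w).IsChain (· ≠ ·) := by
  induction w with
  | nil => exact List.isChain_nil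
  | cons a w ih => rw [reduce_cons]; exact isChain_push a ih

/-- A reduced word is its own normal form. -/
theorem reduce_eq_self {w : List (Fin 4)} (hw : w.IsChain (· ≠ ·)) : reduce w = w := by
  induction w with
  | nil => rfl
  | cons a w ih =>
    rw [reduce_cons, ih hw.tail]
    cases w with
    | nil => rfl
    | cons b t => simp [push, (List.isChain_cons_cons.1 hw).1]

/-- The normal form is not longer than the word. -/
theorem length_reduce_le (w : List (Fin 4)) : (reduce w).length ≤ w.length := by
  induction w with
  | nil => simp
  | cons a w ih =>
    rw [reduce_cons]
    cases h : reduce w with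
    | nil => simp [push]
    | cons b t =>
      rw [h] at ih
      simp only [push]
      split_ifs <;> simp only [List.length_cons] at ih ⊢ <;> omega

/-- **NORMAL FORM THEOREM.**  Two words have the same matrix iff they have the same normal form. -/
theorem wordMat_eq_iff_reduce_eq (u v : List (Fin 4)) : wordMat u = wordMat v ↔ reduce u = reduce v :=
  ⟨fun h => eq_of_wordMat_eq (isChain_reduce u) (isChain_reduce v) (by rwa [wordMat_reduce, wordMat_reduce]),
    fun h => by rw [← wordMat_reduce u, h, wordMat_reduce]⟩

/-- A word is the identity iff it reduces to the empty word. -/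
theorem wordMat_eq_one_iff (w : List (Fin 4)) : wordMat w = 1 ↔ reduce w = [] := by
  simpa using wordMat_eq_iff_reduce_eq w []

/-- Inverse words: `wordMat u.reverse = wordMat v.reverse ↔ wordMat u = wordMat v`. -/
theorem wordMat_reverse_eq_iff (u v : List (Fin 4)) : wordMat u.reverse = wordMat v.reverse ↔ wordMat u = wordMat v := by
  have key : ∀ u v : List (Fin 4), wordMat u = wordMat v → wordMat u.reverse = wordMat v.reverse := fun u v h =>
    calc wordMat u.reverse = wordMat u.reverse * (wordMat v * wordMat v.reverse) := by rw [wordMat_mul_reverse, mul_one]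
      _ = wordMat v.reverse := by rw [← h, ← mul_assoc, wordMat_reverse_mul, one_mul]
  refine ⟨fun h => ?_, key u v⟩
  simpa using key _ _ h

/-- **`Γ₀ ∩ GL₃(ℤ) = {1}`** — in particular `Γ₀ ∩ O_h = {1}` for the cubic point group `O_h` (signed permutation
matrices): a word whose matrix has INTEGER entries reduces to the empty word. -/
theorem reduce_eq_nil_of_forall_intCast {w : List (Fin 4)} (h : ∀ a b, ∃ z : ℤ, wordMat w a b = z) : reduce w = [] := by
  by_contra hne
  obtain ⟨z, hz⟩ := h 0 0
  rw [← wordMat_reduce] at hz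
  exact wordMat_apply_ne_intCast _ hne (isChain_reduce w) 0 0 z hz

/-! ### The slot dozen `D₊` -/

open NearIdentity

/-- The twelve slots of `D₊` in integer cubic coordinates (the tree's `NearIdentity.slotInt`, `(±1,±1,0)`-type) as
rational vectors. -/
def slotQ (s : Fin 12) : Fin 3 → ℚ := fun a => (slotInt s a : ℚ)

/-- Every letter `l` has a FAR SLOT: a slot `s` with `n_l ⬝ s ≢ 0 (mod 3)` (indeed `n_l ⬝ s = ±2`). -/
theorem exists_far_slot : ∀ l : Fin 4, ∃ s : Fin 12, nbar l ⬝ᵥ (fun a => (slotInt s a : ZMod 3)) ≠ 0 := by decide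

/-- **A non-empty reduced word moves a slot of `D₊` off the integer lattice** (no coordinate of the image is an integer);
in particular off `D₊` and off `Λ₀`. -/
theorem exists_slot_mulVec_ne_intCast (w : List (Fin 4)) (hw : w ≠ []) (hred : w.IsChain (· ≠ ·)) :
    ∃ s : Fin 12, ∀ (a : Fin 3) (z : ℤ), (wordMat w *ᵥ slotQ s) a ≠ z := by
  obtain ⟨s, hs⟩ := exists_far_slot (w.getLast hw)
  exact ⟨s, fun a z => wordMat_mulVec_apply_ne_intCast w hw hred (slotInt s) hs a z⟩

/-- **TRIVIAL STABILISER OF `D₊`**: a word mapping every slot of `D₊` to a slot of `D₊` reduces to the empty word. -/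
theorem reduce_eq_nil_of_mapsTo_slots {w : List (Fin 4)} (h : ∀ s : Fin 12, ∃ s' : Fin 12, wordMat w *ᵥ slotQ s = slotQ s') :
    reduce w = [] := by
  by_contra hne
  obtain ⟨s, hs⟩ := exists_slot_mulVec_ne_intCast (reduce w) hne (isChain_reduce w)
  obtain ⟨s', hs'⟩ := h s
  rw [← wordMat_reduce] at hs'
  exact hs 0 (slotInt s' 0) (by rw [hs']; rfl)

/-- **RIGIDITY OF SLOT IMAGES**: if `M_u D₊ ⊆ M_v D₊` then `u` and `v` have the same normal form (so two REDUCED words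
with the same slot-dozen image are EQUAL, `eq_of_wordMat_eq`). -/
theorem reduce_eq_of_mapsTo_slots {u v : List (Fin 4)}
    (h : ∀ s : Fin 12, ∃ s' : Fin 12, wordMat u *ᵥ slotQ s = wordMat v *ᵥ slotQ s') : reduce u = reduce v := by
  have h' : ∀ s : Fin 12, ∃ s' : Fin 12, wordMat (v.reverse ++ u) *ᵥ slotQ s = slotQ s' := by
    intro s
    obtain ⟨s', hs'⟩ := h s
    refine ⟨s', ?_⟩
    rw [wordMat_append, ← Matrix.mulVec_mulVec, hs', Matrix.mulVec_mulVec, wordMat_reverse_mul, Matrix.one_mulVec]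
  have h1 : wordMat (v.reverse ++ u) = 1 := (wordMat_eq_one_iff _).2 (reduce_eq_nil_of_mapsTo_slots h')
  rw [← wordMat_eq_iff_reduce_eq]
  calc wordMat u = wordMat v * (wordMat v.reverse * wordMat u) := by rw [← mul_assoc, wordMat_mul_reverse, one_mul]
    _ = wordMat v := by rw [← wordMat_append, h1, mul_one]

end ReflWord

end Summit.Ventures.Crystal3D.Theorems
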